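import Mathlib
import Literature.NumberTheory.Transcendental.KZRayDilog
import Literature.NumberTheory.Transcendental.KZIdealTetrahedron
import Literature.NumberTheory.Transcendental.KZCalculusProofs
import Literature.NumberTheory.Transcendental.BlochWignerIdealTetrahedronVolume
import Literature.NumberTheory.Transcendental.SemialgebraicMapsProofs
import Literature.NumberTheory.Transcendental.KZSemialgebraicComplex

/-!
# `OffTetraSectorKernel`, line `flat-shadow`: the V-cell (stub `stub_vCell`)

Stub `stub_vCell` of the crux `OffTetraSectorKernel` (stmt-KontsevichZagierPeriods-10557, route
HyperbolicBloch), station (M4) of the Milnor bridge: Kontsevich–Zagier's rule (2) for the CELL MAP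
of the fan cell. Notation: `z = a + ib` algebraic, `b > 0`, `N = |z|²`, `c = N − 2a`,
`Q(s) = (1 − sa)² + (sb)² > 0`, `M(s) = N s(1 − s)`, `h(s, λ) = Q(s)(1 − λ) + M(s)`; coordinates
`v 0 = s`, `v 1 = λ` on the square and `w 0 = s`, `w 1 = v` on the cell. The polynomial map
`Ψ(s, λ) = (s, h(s, λ)) = (s, Q(s)(1 − λ) + M(s))` maps the open unit square `(0,1)²` injectively
(`Q ≠ 0`) ONTO the V-cell `{0 < s < 1, M(s) < v < 1 + c s}` (as `λ` runs over `(0, 1)`,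
`v = Q(1 − λ) + M` runs over `(M, Q + M)` and `Q(s) + M(s) = 1 + c s`; inverse
`λ = 1 − (v − M)/Q`), with derivative `[[1, 0], [∂h/∂s, −Q(s)]]` of determinant `−Q(s)`. The
Jacobian identity `b/(2h) = b/(2 Q v)|_{v = h} · |−Q|` makes `[(0,1)², b/(2h)] − [V-cell, b/(2Qv)]`
ONE element of `KZ.changeOfVariablesRel`, and a representation `[V-cell, b/(2Qv)]` EXISTS: the
cell `Ψ((0,1)²)` is `ℚ`-semialgebraic by Tarski–Seidenberg
(`IsSemialgebraicMapOn.isSemialgebraic_image_holds`), `b/(2Qv)` is a quotient of polynomials with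
real-algebraic coefficients and denominator `2 Q v > 0` on the cell (`v > M > 0`), and it is
integrable on `Ψ((0,1)²)` by Mathlib's change-of-variables criterion
`MeasureTheory.integrableOn_image_iff_integrableOn_abs_det_fderiv_smul` (the pulled-back integrand
`|det DΨ| · b/(2 Q h)` IS `b/(2h) = f.integrand` on the square).

References: M. Kontsevich, D. Zagier, *Periods* (2001), §1.2 rule (2); J. Milnor, *Hyperbolic
geometry: the first 150 years* (1982), Appendix; J. Bochnak, M. Coste, M.-F. Roy, *Real Algebraic
Geometry* (1998), §2.2 (Prop. 2.2.6, 2.2.7).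
-/

noncomputable section

open Set MeasureTheory MvPolynomial
open Literature.NumberTheory.Transcendental Literature.ModelTheory.ExponentialFields
open Literature.NumberTheory.Transcendental.IdealTetrahedronVolume (sq01 normSq_pos_of_im_pos)

namespace Summit.KontsevichZagierPeriods.HyperbolicBloch.OffTetraSectorKernel

variable {z : ℂ}

/-! ## Algebra of the cell map -/

/-- The coordinates of the cell map `Ψ(s, λ) = (s, Q(s)(1 − λ) + |z|² s(1 − s))`. [folklore] -/
theorem vCell_apply (Ψ : (Fin 2 → ℝ) → (Fin 2 → ℝ))
    (hΨ : ∀ v, Ψ v = ![v 0, ((1 - v 0 * z.re) ^ 2 + (v 0 * z.im) ^ 2) * (1 - v 1) +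
      Complex.normSq z * v 0 * (1 - v 0)]) (v : Fin 2 → ℝ) :
    Ψ v 0 = v 0 ∧ Ψ v 1 = ((1 - v 0 * z.re) ^ 2 + (v 0 * z.im) ^ 2) * (1 - v 1) +
      Complex.normSq z * v 0 * (1 - v 0) := by
  rw [hΨ]
  exact ⟨rfl, rfl⟩

/-- `Q(s) + M(s) = 1 + c s`: `(1 − sa)² + (sb)² + |z|² s(1 − s) = 1 + (|z|² − 2a) s`
(`|z|² = a² + b²`). [folklore] -/
theorem vCell_Q_add_M (z : ℂ) (s : ℝ) :
    (1 - s * z.re) ^ 2 + (s * z.im) ^ 2 + Complex.normSq z * s * (1 - s) =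
      1 + (Complex.normSq z - 2 * z.re) * s := by
  rw [Complex.normSq_apply]
  ring

/-- `Q(s) = (1 − sa)² + (sb)² > 0` (`b ≠ 0`). [folklore] -/
theorem vCell_Q_pos (hz : 0 < z.im) (s : ℝ) : 0 < (1 - s * z.re) ^ 2 + (s * z.im) ^ 2 :=
  KZ.rayDilog_den_pos hz.ne' z.re s

/-- `M(s) = |z|² s(1 − s) > 0` for `0 < s < 1` (`|z|² > 0`). [folklore] -/
theorem vCell_M_pos (hz : 0 < z.im) {s : ℝ} (h0 : 0 < s) (h1 : s < 1) :
    0 < Complex.normSq z * s * (1 - s) :=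
  mul_pos (mul_pos (normSq_pos_of_im_pos hz) h0) (by linarith)

/-- **The image of the unit square under the cell map is the V-cell**
`{0 < s < 1, M(s) < v < 1 + c s}`: for fixed `s`, `λ ↦ Q(s)(1 − λ) + M(s)` is an affine bijection
of `(0, 1)` onto `(M(s), Q(s) + M(s)) = (M(s), 1 + c s)` (`Q > 0`), with inverse
`λ = 1 − (v − M(s))/Q(s)`. [cite: Milnor1982, Appendix (upper half-space model)] -/
theorem vCell_image (Ψ : (Fin 2 → ℝ) → (Fin 2 → ℝ))
    (hΨ : ∀ v, Ψ v = ![v 0, ((1 - v 0 * z.re) ^ 2 + (v 0 * z.im) ^ 2) * (1 - v 1) +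
      Complex.normSq z * v 0 * (1 - v 0)]) (hz : 0 < z.im) :
    Ψ '' sq01 = {w | 0 < w 0 ∧ w 0 < 1 ∧ Complex.normSq z * w 0 * (1 - w 0) < w 1 ∧ w 1 < 1 + (Complex.normSq z - 2 * z.re) * w 0} := by
  ext w
  constructor
  · -- `Ψ` maps the square into the cell
    rintro ⟨v, ⟨h0, h1, hl0, hl1⟩, rfl⟩
    obtain ⟨e0, e1⟩ := vCell_apply Ψ hΨ v
    simp only [mem_setOf_eq, e0, e1]
    have hQ := vCell_Q_pos hz (v 0)
    have hQM := vCell_Q_add_M z (v 0)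
    refine ⟨h0, h1, ?_, ?_⟩
    · have h : 0 < ((1 - v 0 * z.re) ^ 2 + (v 0 * z.im) ^ 2) * (1 - v 1) :=
        mul_pos hQ (by linarith)
      linarith
    · have h : 0 < ((1 - v 0 * z.re) ^ 2 + (v 0 * z.im) ^ 2) * v 1 := mul_pos hQ hl0
      have hid : ((1 - v 0 * z.re) ^ 2 + (v 0 * z.im) ^ 2) * (1 - v 1) +
          Complex.normSq z * v 0 * (1 - v 0) =
          ((1 - v 0 * z.re) ^ 2 + (v 0 * z.im) ^ 2 + Complex.normSq z * v 0 * (1 - v 0)) -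
            ((1 - v 0 * z.re) ^ 2 + (v 0 * z.im) ^ 2) * v 1 := by ring
      rw [hid, hQM]
      linarith
  · -- the cell is covered: `λ = 1 − (v − M)/Q`
    rintro ⟨h0, h1, hM, hc⟩
    have hQ := vCell_Q_pos hz (w 0)
    have hQM := vCell_Q_add_M z (w 0)
    have hQne : (1 - w 0 * z.re) ^ 2 + (w 0 * z.im) ^ 2 ≠ 0 := hQ.ne'
    refine ⟨![w 0, 1 - (w 1 - Complex.normSq z * w 0 * (1 - w 0)) /
      ((1 - w 0 * z.re) ^ 2 + (w 0 * z.im) ^ 2)], ?_, ?_⟩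
    · have hlt : (w 1 - Complex.normSq z * w 0 * (1 - w 0)) /
          ((1 - w 0 * z.re) ^ 2 + (w 0 * z.im) ^ 2) < 1 := by
        rw [div_lt_one hQ]
        linarith
      have hgt : 0 < (w 1 - Complex.normSq z * w 0 * (1 - w 0)) /
          ((1 - w 0 * z.re) ^ 2 + (w 0 * z.im) ^ 2) := div_pos (by linarith) hQ
      simp only [sq01, mem_setOf_eq, Matrix.cons_val_zero, Matrix.cons_val_one,
        Matrix.cons_val_fin_one]
      exact ⟨h0, h1, by linarith, by linarith⟩
    · rw [hΨ]
      funext i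
      fin_cases i
      · simp
      · simp only [Fin.mk_one, Fin.isValue, Matrix.cons_val_one, Matrix.cons_val_zero,
          Matrix.cons_val_fin_one]
        field_simp
        ring

/-- The cell map is injective (`Q ≠ 0`): the first coordinate is kept, and for fixed `s` the
second is affine in `λ` with slope `−Q(s) ≠ 0`. [folklore] -/
theorem vCell_injective (Ψ : (Fin 2 → ℝ) → (Fin 2 → ℝ))
    (hΨ : ∀ v, Ψ v = ![v 0, ((1 - v 0 * z.re) ^ 2 + (v 0 * z.im) ^ 2) * (1 - v 1) +
      Complex.normSq z * v 0 * (1 - v 0)]) (hz : 0 < z.im) : Function.Injective Ψ := by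
  intro v v' h
  obtain ⟨e0, e1⟩ := vCell_apply Ψ hΨ v
  obtain ⟨e0', e1'⟩ := vCell_apply Ψ hΨ v'
  have h0 : v 0 = v' 0 := by rw [← e0, ← e0', h]
  have h1 : Ψ v 1 = Ψ v' 1 := by rw [h]
  rw [e1, e1', ← h0] at h1
  have hQ := vCell_Q_pos hz (v 0)
  have h2 : ((1 - v 0 * z.re) ^ 2 + (v 0 * z.im) ^ 2) * (1 - v 1) =
      ((1 - v 0 * z.re) ^ 2 + (v 0 * z.im) ^ 2) * (1 - v' 1) := add_right_cancel h1
  have h3 : 1 - v 1 = 1 - v' 1 := mul_left_cancel₀ hQ.ne' h2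
  funext i
  fin_cases i
  · exact h0
  · show v 1 = v' 1
    linarith

/-! ## Semialgebraicity -/

/-- The cell map is a `ℚ`-semialgebraic map on every `ℚ`-semialgebraic set when `Re z`, `Im z`
are algebraic: its coordinates `s` and `Q(s)(1 − λ) + |z|² s(1 − s)` are polynomials with
real-algebraic coefficients, and real-algebraic constants are `ℚ`-definable
(`isSemialgebraicFunOn_const_of_isAlgebraic`). [cite: KontsevichZagier2001, §1.1] -/
theorem vCell_isSemialgebraicMapOn (Ψ : (Fin 2 → ℝ) → (Fin 2 → ℝ))
    (hΨ : ∀ v, Ψ v = ![v 0, ((1 - v 0 * z.re) ^ 2 + (v 0 * z.im) ^ 2) * (1 - v 1) +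
      Complex.normSq z * v 0 * (1 - v 0)]) (hre : IsAlgebraic ℚ z.re)
    (him : IsAlgebraic ℚ z.im) {σ : Set (Fin 2 → ℝ)} (hσ : IsSemialgebraic ℚ σ) :
    IsSemialgebraicMapOn ℚ σ Ψ := by
  have s0 : IsSemialgebraicFunOn ℚ σ (fun w => w 0) :=
    (isSemialgebraicFunOn_aeval hσ (X 0)).congr fun w _ => by simp
  have s1 : IsSemialgebraicFunOn ℚ σ (fun w => w 1) :=
    (isSemialgebraicFunOn_aeval hσ (X 1)).congr fun w _ => by simp
  have sone : IsSemialgebraicFunOn ℚ σ (fun _ => (1 : ℝ)) := by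
    simpa using isSemialgebraicFunOn_natCast (k := ℚ) (R := ℝ) hσ 1
  have sre : IsSemialgebraicFunOn ℚ σ (fun _ => z.re) :=
    isSemialgebraicFunOn_const_of_isAlgebraic hσ hre
  have sim : IsSemialgebraicFunOn ℚ σ (fun _ => z.im) :=
    isSemialgebraicFunOn_const_of_isAlgebraic hσ him
  have sN : IsSemialgebraicFunOn ℚ σ (fun _ => Complex.normSq z) := by
    refine isSemialgebraicFunOn_const_of_isAlgebraic hσ ?_
    rw [Complex.normSq_apply]
    exact (hre.mul hre).add (him.mul him)
  have sQa := IsSemialgebraicFunOn.sub_holds sone (IsSemialgebraicFunOn.mul_holds s0 sre)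
  have sQb := IsSemialgebraicFunOn.mul_holds s0 sim
  have sh : IsSemialgebraicFunOn ℚ σ (fun v => ((1 - v 0 * z.re) ^ 2 + (v 0 * z.im) ^ 2) *
      (1 - v 1) + Complex.normSq z * v 0 * (1 - v 0)) := by
    refine (IsSemialgebraicFunOn.add_holds
      (IsSemialgebraicFunOn.mul_holds
        (IsSemialgebraicFunOn.add_holds (IsSemialgebraicFunOn.mul_holds sQa sQa)
          (IsSemialgebraicFunOn.mul_holds sQb sQb))
        (IsSemialgebraicFunOn.sub_holds sone s1))
      (IsSemialgebraicFunOn.mul_holds (IsSemialgebraicFunOn.mul_holds sN s0)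
        (IsSemialgebraicFunOn.sub_holds sone s0))).congr fun v _ => ?_
    simp only [Pi.mul_apply, Pi.add_apply, Pi.sub_apply]
    ring
  refine IsSemialgebraicMapOn.of_forall hσ fun j => ?_
  fin_cases j
  · exact s0.congr fun w _ => by simp [(vCell_apply Ψ hΨ w).1]
  · exact sh.congr fun w _ => by simp [(vCell_apply Ψ hΨ w).2]

/-- The cell density `b/(2 Q(s) v)` is a `ℚ`-semialgebraic function on every `ℚ`-semialgebraic
`σ ⊆ {v > 0}` for algebraic `Re z`, `Im z`: a quotient of polynomials with real-algebraic
coefficients whose denominator `2 Q(s) v` does not vanish on `σ` (`Q > 0`, `v > 0`).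
[cite: KontsevichZagier2001, §1.1] -/
theorem vCell_isSemialgebraicFunOn (hre : IsAlgebraic ℚ z.re) (him : IsAlgebraic ℚ z.im)
    (hz : 0 < z.im) {σ : Set (Fin 2 → ℝ)} (hσ : IsSemialgebraic ℚ σ) (hpos : ∀ w ∈ σ, 0 < w 1) :
    IsSemialgebraicFunOn ℚ σ
      (fun w => z.im / (2 * ((1 - w 0 * z.re) ^ 2 + (w 0 * z.im) ^ 2) * w 1)) := by
  have s0 : IsSemialgebraicFunOn ℚ σ (fun w => w 0) :=
    (isSemialgebraicFunOn_aeval hσ (X 0)).congr fun w _ => by simp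
  have s1 : IsSemialgebraicFunOn ℚ σ (fun w => w 1) :=
    (isSemialgebraicFunOn_aeval hσ (X 1)).congr fun w _ => by simp
  have sone : IsSemialgebraicFunOn ℚ σ (fun _ => (1 : ℝ)) := by
    simpa using isSemialgebraicFunOn_natCast (k := ℚ) (R := ℝ) hσ 1
  have stwo : IsSemialgebraicFunOn ℚ σ (fun _ => (2 : ℝ)) := by
    simpa using isSemialgebraicFunOn_natCast (k := ℚ) (R := ℝ) hσ 2
  have sre : IsSemialgebraicFunOn ℚ σ (fun _ => z.re) :=
    isSemialgebraicFunOn_const_of_isAlgebraic hσ hre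
  have sim : IsSemialgebraicFunOn ℚ σ (fun _ => z.im) :=
    isSemialgebraicFunOn_const_of_isAlgebraic hσ him
  have sQa := IsSemialgebraicFunOn.sub_holds sone (IsSemialgebraicFunOn.mul_holds s0 sre)
  have sQb := IsSemialgebraicFunOn.mul_holds s0 sim
  have sden : IsSemialgebraicFunOn ℚ σ
      (fun w => 2 * ((1 - w 0 * z.re) ^ 2 + (w 0 * z.im) ^ 2) * w 1) := by
    refine (IsSemialgebraicFunOn.mul_holds (IsSemialgebraicFunOn.mul_holds stwo
      (IsSemialgebraicFunOn.add_holds (IsSemialgebraicFunOn.mul_holds sQa sQa)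
        (IsSemialgebraicFunOn.mul_holds sQb sQb))) s1).congr fun w _ => ?_
    simp only [Pi.mul_apply, Pi.add_apply, Pi.sub_apply]
    ring
  exact IsSemialgebraicFunOn.div sim sden fun w hw =>
    (mul_pos (mul_pos two_pos (vCell_Q_pos hz (w 0))) (hpos w hw)).ne'

/-! ## The derivative -/

/-- **The derivative of the cell map and its determinant.** `Ψ` is polynomial; at every point it
has the Fréchet derivative of matrix `[[1, 0], [∂h/∂s, −Q(s)]]`
(`∂h/∂s = (−2a(1 − sa) + 2 s b²)(1 − λ) + |z|²(1 − 2s)`), of determinant `−Q(s)`. [folklore] -/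
theorem vCell_hasFDerivAt_det (Ψ : (Fin 2 → ℝ) → (Fin 2 → ℝ))
    (hΨ : ∀ v, Ψ v = ![v 0, ((1 - v 0 * z.re) ^ 2 + (v 0 * z.im) ^ 2) * (1 - v 1) +
      Complex.normSq z * v 0 * (1 - v 0)]) (v : Fin 2 → ℝ) :
    ∃ L : (Fin 2 → ℝ) →L[ℝ] (Fin 2 → ℝ), HasFDerivAt Ψ L v ∧
      L.det = -((1 - v 0 * z.re) ^ 2 + (v 0 * z.im) ^ 2) := by
  set M : Matrix (Fin 2) (Fin 2) ℝ := !![1, 0;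
    (-(2 * z.re * (1 - v 0 * z.re)) + 2 * v 0 * z.im ^ 2) * (1 - v 1) +
      Complex.normSq z * (1 - 2 * v 0),
    -((1 - v 0 * z.re) ^ 2 + (v 0 * z.im) ^ 2)] with hM
  refine ⟨LinearMap.toContinuousLinearMap (Matrix.toLin' M), ?_, ?_⟩
  · -- derivative, componentwise
    have e0 : HasFDerivAt (fun x : Fin 2 → ℝ => x 0) (ContinuousLinearMap.proj 0) v :=
      hasFDerivAt_apply (𝕜 := ℝ) 0 v
    have e1 : HasFDerivAt (fun x : Fin 2 → ℝ => x 1) (ContinuousLinearMap.proj 1) v :=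
      hasFDerivAt_apply (𝕜 := ℝ) 1 v
    have h0 : HasFDerivAt (fun x => Ψ x 0)
        ((ContinuousLinearMap.proj 0).comp (LinearMap.toContinuousLinearMap (Matrix.toLin' M)))
        v := by
      have hf : (fun x => Ψ x 0) = fun x : Fin 2 → ℝ => x 0 := by
        funext x
        exact (vCell_apply Ψ hΨ x).1
      rw [hf]
      refine e0.congr_fderiv (ContinuousLinearMap.ext fun u => ?_)
      simp [hM, Matrix.toLin'_apply, dotProduct, Fin.sum_univ_two]
    have h1 : HasFDerivAt (fun x => Ψ x 1)
        ((ContinuousLinearMap.proj 1).comp (LinearMap.toContinuousLinearMap (Matrix.toLin' M)))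
        v := by
      have hf : (fun x => Ψ x 1) = fun x : Fin 2 → ℝ =>
          ((1 - x 0 * z.re) * (1 - x 0 * z.re) + x 0 * z.im * (x 0 * z.im)) * (1 - x 1) +
            Complex.normSq z * x 0 * (1 - x 0) := by
        funext x
        rw [(vCell_apply Ψ hΨ x).2]
        ring
      rw [hf]
      have hA := (e0.mul_const z.re).const_sub 1
      have hB := e0.mul_const z.im
      have hcomp := (((hA.fun_mul hA).fun_add (hB.fun_mul hB)).fun_mul (e1.const_sub 1)).fun_add
        ((e0.const_mul (Complex.normSq z)).fun_mul (e0.const_sub 1))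
      refine hcomp.congr_fderiv (ContinuousLinearMap.ext fun u => ?_)
      simp [hM, Matrix.toLin'_apply, dotProduct, Fin.sum_univ_two]
      ring
    refine hasFDerivAt_pi'' fun i => ?_
    fin_cases i
    exacts [h0, h1]
  · -- determinant
    rw [LinearMap.det_toContinuousLinearMap, LinearMap.det_toLin', Matrix.det_fin_two]
    simp [hM]

/-- **Cell-map move data**: a derivative `Ψ'` of `Ψ` at every point together with the Jacobian
identity `b/(2 h(s, λ)) = b/(2 Q(s) (Ψ v)₁) · |det Ψ' v|` (`(Ψ v)₁ = h(s, λ)`,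
`|det Ψ' v| = |−Q(s)| = Q(s) ≠ 0`). [cite: KontsevichZagier2001, §1.2 rule (2)] -/
theorem vCell_moveData (Ψ : (Fin 2 → ℝ) → (Fin 2 → ℝ))
    (hΨ : ∀ v, Ψ v = ![v 0, ((1 - v 0 * z.re) ^ 2 + (v 0 * z.im) ^ 2) * (1 - v 1) +
      Complex.normSq z * v 0 * (1 - v 0)]) (hz : 0 < z.im) :
    ∃ Ψ' : (Fin 2 → ℝ) → ((Fin 2 → ℝ) →L[ℝ] (Fin 2 → ℝ)), ∀ v, HasFDerivAt Ψ (Ψ' v) v ∧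
      z.im / (2 * (((1 - v 0 * z.re) ^ 2 + (v 0 * z.im) ^ 2) * (1 - v 1) +
        Complex.normSq z * v 0 * (1 - v 0))) =
        z.im / (2 * ((1 - Ψ v 0 * z.re) ^ 2 + (Ψ v 0 * z.im) ^ 2) * Ψ v 1) * |(Ψ' v).det| := by
  choose L hL using vCell_hasFDerivAt_det Ψ hΨ
  refine ⟨L, fun v => ⟨(hL v).1, ?_⟩⟩
  obtain ⟨e0, e1⟩ := vCell_apply Ψ hΨ v
  have hQ := vCell_Q_pos hz (v 0)
  rw [(hL v).2, e0, e1, abs_neg, abs_of_pos hQ, div_mul_eq_mul_div, mul_right_comm (2 : ℝ),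
    mul_div_mul_right _ _ hQ.ne']

/-! ## The stub -/

/-- **STUB `stub_vCell`** (V-cell; Kontsevich–Zagier's rule (2) for the cell map
`Ψ(s, λ) = (s, Q(s)(1 − λ) + |z|² s(1 − s))` of `(0,1)²` onto the V-cell
`{0 < s < 1, |z|² s(1 − s) < v < 1 + (|z|² − 2 Re z) s}`). For algebraic `z` with `Im z > 0` and
every fan-cell representation `f = [(0,1)², b/(2h)]`: a V-cell representation
`V = [V-cell, b/(2 Q(s) v)]` EXISTS (semialgebraic image by Tarski–Seidenberg; quotient integrand
with real-algebraic coefficients and denominator `2 Q v > 0`; integrable by the change-of-variables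
criterion, the pulled-back density `|det DΨ| · b/(2 Q h)` being `b/(2h) = f.integrand` on the
square), and EVERY such `V` is KZ-equivalent to `f` by the single move
`[f] − [V] ∈ changeOfVariablesRel` (`Ψ` semialgebraic, injective, derivative
`[[1, 0], [∂h/∂s, −Q]]`, image the V-cell, `b/(2h) = b/(2 Q v) ∘ Ψ · |det DΨ|`).
[cite: KontsevichZagier2001, §1.2 rule (2)] -/
theorem stub_vCell : ∀ z : ℂ, IsAlgebraic ℚ z → 0 < z.im → ∀ f : Literature.NumberTheory.Transcendental.KZ.IntegralRep 2, f.domain = {v | 0 < v 0 ∧ v 0 < 1 ∧ 0 < v 1 ∧ v 1 < 1} → Set.EqOn f.integrand (fun v => z.im / (2 * (((1 - v 0 * z.re) ^ 2 + (v 0 * z.im) ^ 2) * (1 - v 1) + Complex.normSq z * v 0 * (1 - v 0)))) f.domain → (∃ V : Literature.NumberTheory.Transcendental.KZ.IntegralRep 2, V.domain = {w | 0 < w 0 ∧ w 0 < 1 ∧ Complex.normSq z * w 0 * (1 - w 0) < w 1 ∧ w 1 < 1 + (Complex.normSq z - 2 * z.re) * w 0} ∧ Set.EqOn V.integrand (fun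 w => z.im / (2 * ((1 - w 0 * z.re) ^ 2 + (w 0 * z.im) ^ 2) * w 1)) V.domain) ∧ (∀ V : Literature.NumberTheory.Transcendental.KZ.IntegralRep 2, V.domain = {w | 0 < w 0 ∧ w 0 < 1 ∧ Complex.normSq z * w 0 * (1 - w 0) < w 1 ∧ w 1 < 1 + (Complex.normSq z - 2 * z.re) * w 0} → Set.EqOn V.integrand (fun w => z.im / (2 * ((1 - w 0 * z.re) ^ 2 + (w 0 * z.im) ^ 2) * w 1)) V.domain → Literature.NumberTheory.Transcendental.KZ.Equivalent f V) := by
  intro z hz him f hf hfi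
  obtain ⟨hre, him'⟩ := isAlgebraic_re_im hz
  -- the move `Ψ(s, λ) = (s, Q(s)(1 − λ) + |z|² s(1 − s))`
  set Ψ : (Fin 2 → ℝ) → (Fin 2 → ℝ) := fun v => ![v 0, ((1 - v 0 * z.re) ^ 2 + (v 0 * z.im) ^ 2) *
    (1 - v 1) + Complex.normSq z * v 0 * (1 - v 0)] with hΨdef
  have hΨ : ∀ v, Ψ v = ![v 0, ((1 - v 0 * z.re) ^ 2 + (v 0 * z.im) ^ 2) * (1 - v 1) +
      Complex.normSq z * v 0 * (1 - v 0)] := fun _ => rfl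
  have hf' : f.domain = sq01 := hf
  -- the image is the V-cell
  have himage : Ψ '' f.domain = {w | 0 < w 0 ∧ w 0 < 1 ∧ Complex.normSq z * w 0 * (1 - w 0) < w 1 ∧ w 1 < 1 + (Complex.normSq z - 2 * z.re) * w 0} := by
    rw [hf']
    exact vCell_image Ψ hΨ him
  -- the four data of the move
  have hΨsa : IsSemialgebraicMapOn ℚ f.domain Ψ :=
    vCell_isSemialgebraicMapOn Ψ hΨ hre him' f.isSemialgebraic_domain
  have hinj : InjOn Ψ f.domain := (vCell_injective Ψ hΨ him).injOn
  obtain ⟨Ψ', hΨ'⟩ := vCell_moveData Ψ hΨ him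
  have hderiv : ∀ x ∈ f.domain, HasFDerivWithinAt Ψ (Ψ' x) f.domain x := fun x _ =>
    (hΨ' x).1.hasFDerivWithinAt
  have hjac : ∀ x ∈ f.domain, f.integrand x =
      z.im / (2 * ((1 - Ψ x 0 * z.re) ^ 2 + (Ψ x 0 * z.im) ^ 2) * Ψ x 1) * |(Ψ' x).det| := by
    intro x hx
    rw [hfi hx]
    exact (hΨ' x).2
  have hmeas : MeasurableSet f.domain := KZ.IntegralRep.measurableSet_domain_holds f
  -- EXISTENCE of `[V-cell, b/(2 Q v)]`: semialgebraic image, quotient integrand, change of variables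
  have hT : IsSemialgebraic ℚ (Ψ '' f.domain) :=
    IsSemialgebraicMapOn.isSemialgebraic_image_holds hΨsa subset_rfl f.isSemialgebraic_domain
  have hpos : ∀ w ∈ Ψ '' f.domain, 0 < w 1 := by
    rw [himage]
    rintro w ⟨h0, h1, hM, -⟩
    exact (vCell_M_pos him h0 h1).trans hM
  have hF := vCell_isSemialgebraicFunOn hre him' him hT hpos
  have hI : IntegrableOn
      (fun w : Fin 2 → ℝ => z.im / (2 * ((1 - w 0 * z.re) ^ 2 + (w 0 * z.im) ^ 2) * w 1))
      (Ψ '' f.domain) := by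
    rw [integrableOn_image_iff_integrableOn_abs_det_fderiv_smul volume hmeas hderiv hinj]
    refine f.integrableOn.congr_fun (fun x hx => ?_) hmeas
    rw [hjac x hx, smul_eq_mul, mul_comm]
  refine ⟨⟨⟨Ψ '' f.domain, _, hT, hF, hI⟩, himage, fun _ _ => rfl⟩, ?_⟩
  -- EVERY `[V-cell, b/(2 Q v)]` is one change-of-variables move away from `f`
  intro V hV hVi
  refine KZ.changeOfVariablesRel_subset_relations
    ⟨2, f, V, Ψ, Ψ', hΨsa, hderiv, hinj, hV.trans himage.symm, fun x hx => ?_, rfl⟩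
  have hx' : Ψ x ∈ V.domain := by
    rw [hV, ← himage]
    exact mem_image_of_mem Ψ hx
  rw [hjac x hx, hVi hx']

end Summit.KontsevichZagierPeriods.HyperbolicBloch.OffTetraSectorKernel

end
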